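import Summits.Ventures.HSemireg.WedgeHankelPairKernel

/-!
# Venture HSemireg — THE KERNEL OF THE POINT PAIR `a·1 + c·pt` IS THE INTERSECTION OF THE KERNELS OF `𝒪` AND OF THE POINT:
# `Kr(univ, w_m(a,0,…,0,c), k) = (Σ_a x_a ∧ ⋀^{k−1}) ∩ (Σ_a y_a ∧ ⋀^{k−1})` for `0 < k < m` — th-7's Cor. A.4 in the one-factor kernel dictionary

HONEST FRAMING. Part of the Lean index of the computation cell `pub-hsemireg` (seat p10 gen 13, Sunday typer «UNIFORM-IN-n»).
Finite-dimensional EXTERIOR ALGEBRA over a field and ranks of HANKEL MATRICES ONLY: no variety, no cohomology theory, no sheaf, no Ext group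
and no semiregularity map is constructed here; nothing here says that HC / HC_CM / HC_AV holds; no Literature fact is declared or used.  Custodian
versions cited: theory/FORMULA-N.md PART A §2.2 THEOREM T (the point pair `a·1 + c·pt`), §2.6 THEOREM H and its KRONECKER DICTIONARY; PART B §A.3 /
Cor. A.4 («the kernel is the span of the mixed monomials»); STRUCTURE.md v1.0-SIGNED 9b196a05977dd067 §1.1 C4 / C15.  The dictionary is QUOTED, never
asserted.

WHAT IS KEYED.  th-7's Cor. A.4 in th-7's own point-pair model (`WedgeBoxKernelSpan.map_ker_wedgeMap_pointPair_eq_span_mixed`, tree: the kernel of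
`θ ↦ θ ∧ (a E_X + c E_Y)` on `⋀^k`, `0 < k < n`, is the span of the mixed monomials); THEOREM T for the two-ended Hankel class (`WedgeHankelBox`, 585:
`w_m(a,0,…,0,c) = a·E_X + c·E_Y`, rank `P_m[k]`); the PURE kernels named (C6 `Kr_xprod` / `xIdeal_eq_frameIdeal`: `𝒪 ↦ E_X`, kernel `F_0(k) = Σ_a x_a ∧
⋀^{k−1}`; C7 `Kr_B_Yset` / `yIdeal_eq_frameIdeal`: the point, kernel `F_∞(k) = Σ_a y_a ∧ ⋀^{k−1}`); C10: a transverse pair has kernel `F_λ ∩ F_μ`.  THIS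
FILE is the slope pair `(0, ∞)` of the same statement, in the one-factor Hankel dictionary:
* §1 `xIdeal k ⊔ yIdeal k = Hom(univ, k)` for `k ≥ 1` (every non-empty monomial meets a block); **`finrank_xIdeal_inf_yIdeal_add`:
  `dim (xIdeal k ∩ yIdeal k) + 2C(m,k) = C(2m,k)`** (the mixed monomials, counted through the two pure counts).
* §2 **`Kr_w_ppSeq`: for `a, c ≠ 0`, `0 < k < m`: `Kr(univ, w_m(a,0,…,0,c), k) = xIdeal k ∩ yIdeal k = F_0(k) ∩ F_∞(k)`** — the forms killing the point
  pair are exactly those killing BOTH `𝒪`'s class `E_X` and the point's class `E_Y` (= the span of the monomials meeting both blocks, th-7's Cor. A.4,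
  here obtained by containment + 585's THEOREM T count + C1's rank–nullity); independent of `a, c`; wedge form.
NOT typed here: the degrees `k ≥ m` (THEOREM T's purity drop); anything Ext-side.  Class side only.
Namespace `Summit.Ventures.HSemireg.Wedge.HankelPureKernel` (continued); new names only.
-/

open Module

namespace Summit.Ventures.HSemireg.Wedge.HankelPureKernel

open Summit.Ventures.HSemireg.Wedge Summit.Ventures.HSemireg.Wedge.Kunneth Summit.Ventures.HSemireg.Wedge.KunnethKernel
  Summit.Ventures.HSemireg.Wedge.HankelFaces Summit.Ventures.HSemireg.Wedge.HankelBox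

variable (K : Type*) [Field K] (m : ℕ)

/-! ## §1. The two pure monomial ideals: their sum is everything; the count of their intersection -/

/-- **`xIdeal k + yIdeal k = Hom(univ, k)` for `k ≥ 1`**: every non-empty monomial meets the `x`-block or the `y`-block. -/
theorem xIdeal_sup_yIdeal {k : ℕ} (hk : 1 ≤ k) : xIdeal K m k ⊔ yIdeal K m k = Hom K (Hankel.In m) Finset.univ k := by
  classical
  apply le_antisymm
  · refine sup_le ?_ ?_
    · rw [← Kr_xprod]; exact Kr_le_Hom K _ _ _
    · rw [← Kr_B_Yset]; exact Kr_le_Hom K _ _ _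
  · rw [Hom, Submodule.span_le]
    rintro _ ⟨s, ⟨-, hsk⟩, rfl⟩
    obtain ⟨i, hi⟩ : s.Nonempty := Finset.card_pos.mp (by omega)
    by_cases him : (i : ℕ) < m
    · exact Submodule.mem_sup_left (Weil.B_mem_Sp ⟨hsk, i, hi, him⟩)
    · exact Submodule.mem_sup_right (Weil.B_mem_Sp ⟨hsk, i, hi, by omega⟩)

/-- the frame of slope `0` is the `x`-frame. -/
lemma uvec_zero : uvec K m (0 : K) = Hankel.X K m := by
  funext a; rw [uvec, zero_smul, add_zero]

/-- `dim xIdeal k + C(m,k) = C(2m,k)` (C6's count for the `x`-frame, slope `0`). -/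
theorem finrank_xIdeal_add {k : ℕ} (hk : 1 ≤ k) : finrank K (xIdeal K m k) + m.choose k = (m + m).choose k := by
  have h := finrank_frameIdeal_uvec K m (0 : K) hk
  rw [uvec_zero, ← xIdeal_eq_frameIdeal K m hk] at h
  have hle : m.choose k ≤ (m + m).choose k := Nat.choose_le_choose k (by omega)
  omega

/-- **`dim (xIdeal k ∩ yIdeal k) + 2C(m,k) = C(2m,k)`** for `k ≥ 1`: the monomials meeting BOTH blocks. -/
theorem finrank_xIdeal_inf_yIdeal_add {k : ℕ} (hk : 1 ≤ k) :
    finrank K ↥(xIdeal K m k ⊓ yIdeal K m k) + 2 * m.choose k = (m + m).choose k := by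
  have hsum := Submodule.finrank_sup_add_finrank_inf_eq (xIdeal K m k) (yIdeal K m k)
  rw [xIdeal_sup_yIdeal K m hk] at hsum
  have hx := finrank_xIdeal_add K m hk
  have hy := finrank_yIdeal_add K m k
  have hH : finrank K ↥(Hom K (Hankel.In m) Finset.univ k) = (m + m).choose k := by
    rw [Hom_univ_eq_exteriorPower, exteriorPower.finrank_eq, finrank_fintype_fun_eq_card, Fintype.card_fin]
  have hle : m.choose k ≤ (m + m).choose k := Nat.choose_le_choose k (by omega)
  omega

/-! ## §2. The kernel of the point pair, named -/

/-- th-7's two-ended class in monomial form: **`w_m(a,0,…,0,c) = a · x₀ ∧ ⋯ ∧ x_{m−1} + c · E_{y-block}`** (`m ≥ 1`). -/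
theorem w_ppSeq_eq (a c : K) :
    Hankel.w K m m (ppSeq K m a c) = Hankel.w K m m (expSeq K a 0) + Hankel.w K m m (ppSeq K m 0 c) := by
  rw [← w_add']
  congr 1
  funext j
  simp only [Pi.add_apply, ppSeq_apply, expSeq_apply]
  rcases Nat.eq_zero_or_pos j with rfl | hj
  · simp
  · rw [zero_pow hj.ne', mul_zero, if_neg hj.ne', zero_add, zero_add, ite_self, zero_add]

/-- **a form killing `𝒪`'s class and the point's class kills the point pair: `xIdeal k ∩ yIdeal k ≤ Kr(univ, w_m(a,0,…,0,c), k)`** (`m ≥ 1`). -/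
theorem xIdeal_inf_yIdeal_le_Kr (hm : 1 ≤ m) (a c : K) (k : ℕ) :
    xIdeal K m k ⊓ yIdeal K m k ≤ Kr K Finset.univ (Hankel.w K m m (ppSeq K m a c)) k := by
  intro θ hθ
  obtain ⟨h1, h2⟩ := Submodule.mem_inf.mp hθ
  rw [← Kr_xprod] at h1
  rw [← Kr_B_Yset] at h2
  obtain ⟨hH, h1⟩ := mem_Kr.mp h1
  obtain ⟨-, h2⟩ := mem_Kr.mp h2
  refine mem_Kr.mpr ⟨hH, ?_⟩
  rw [w_ppSeq_eq K m, w_expSeq, w_ppSeq_zero K m hm, mul_add, mul_smul_comm, mul_smul_comm, h2, smul_zero, add_zero,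
    show uprod K m (0 : K) m = xprod K m m from rfl, h1, smul_zero]

/-- the point pair has kernel dimension `C(2m,k) − 2C(m,k)` for `0 < k < m` (585's THEOREM T + C1's per-degree rank–nullity). -/
theorem finrank_Kr_w_ppSeq_add (hm : 1 ≤ m) {k : ℕ} (hk : 0 < k) (hkm : k < m) {a c : K} (ha : a ≠ 0) (hc : c ≠ 0) :
    finrank K (Kr K Finset.univ (Hankel.w K m m (ppSeq K m a c)) k) + 2 * m.choose k = (m + m).choose k := by
  have h := finrank_Kr_add_finrank_V K (Finset.univ : Finset (Hankel.In m)) (Hankel.w K m m (ppSeq K m a c)) k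
  have hT : finrank K (LinearMap.range (wedge K (Hankel.In m) k (Hankel.w K m m (ppSeq K m a c)))) = 2 * m.choose k := by
    have h2 : finrank K (LinearMap.range (wedge K (Hankel.In m) k (Hankel.w K m m (ppSeq K m a c)))) =
        m.choose k * (Hankel.hankel1 K m k (ppSeq K m a c)).rank := Hankel.hankelLaw_model K k _
    rw [h2, choose_mul_rank_hankel1_ppSeq K m hm ha hc hkm.le, WedgePair.pointPairRank, if_neg (by omega), if_neg (by omega), Nat.sub_zero,
      Nat.sub_zero]
  rw [Finset.card_univ, Fintype.card_fin, V_univ, hT] at h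
  exact h

/-- **THE KERNEL OF THE POINT PAIR IS THE INTERSECTION OF THE KERNELS OF `𝒪` AND OF THE POINT:
`Kr(univ, w_m(a,0,…,0,c), k) = xIdeal k ∩ yIdeal k`** (the span of the monomials meeting both blocks — th-7's Cor. A.4) for `a, c ≠ 0`, `0 < k < m`. -/
theorem Kr_w_ppSeq (hm : 1 ≤ m) {k : ℕ} (hk : 0 < k) (hkm : k < m) {a c : K} (ha : a ≠ 0) (hc : c ≠ 0) :
    Kr K Finset.univ (Hankel.w K m m (ppSeq K m a c)) k = xIdeal K m k ⊓ yIdeal K m k := by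
  refine (Submodule.eq_of_le_of_finrank_eq (xIdeal_inf_yIdeal_le_Kr K m hm a c k) ?_).symm
  have h1 := finrank_xIdeal_inf_yIdeal_add K m (k := k) hk
  have h2 := finrank_Kr_w_ppSeq_add K m hm hk hkm ha hc
  omega

/-- the same with the two pure kernels spelled as frame ideals: **`Kr(univ, w_m(a,0,…,0,c), k) = F_0(k) ∩ F_∞(k)`**
(`F_0 = Σ_a x_a ∧ ⋀^{k−1}`, `F_∞ = Σ_a y_a ∧ ⋀^{k−1}`). -/
theorem Kr_w_ppSeq_eq_frameIdeal_inf (hm : 1 ≤ m) {k : ℕ} (hk : 0 < k) (hkm : k < m) {a c : K} (ha : a ≠ 0) (hc : c ≠ 0) :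
    Kr K Finset.univ (Hankel.w K m m (ppSeq K m a c)) k = frameIdeal K m (Hankel.X K m) k ⊓ frameIdeal K m (Hankel.Y K m) k := by
  rw [Kr_w_ppSeq K m hm hk hkm ha hc, xIdeal_eq_frameIdeal K m hk, yIdeal_eq_frameIdeal K m hk]

/-- the point-pair kernel does not depend on the (non-zero) coefficients. -/
theorem Kr_w_ppSeq_indep (hm : 1 ≤ m) {k : ℕ} (hk : 0 < k) (hkm : k < m) {a c a' c' : K} (ha : a ≠ 0) (hc : c ≠ 0) (ha' : a' ≠ 0) (hc' : c' ≠ 0) :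
    Kr K Finset.univ (Hankel.w K m m (ppSeq K m a c)) k = Kr K Finset.univ (Hankel.w K m m (ppSeq K m a' c')) k := by
  rw [Kr_w_ppSeq K m hm hk hkm ha hc, Kr_w_ppSeq K m hm hk hkm ha' hc']

/-- wedge form: `ker(θ ↦ θ ∧ w_m(a,0,…,0,c) ∣ ⋀^k) = xIdeal k ∩ yIdeal k` (comapped), `0 < k < m`. -/
theorem ker_wedge_w_ppSeq (hm : 1 ≤ m) {k : ℕ} (hk : 0 < k) (hkm : k < m) {a c : K} (ha : a ≠ 0) (hc : c ≠ 0) :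
    LinearMap.ker (wedge K (Hankel.In m) k (Hankel.w K m m (ppSeq K m a c))) =
      (xIdeal K m k ⊓ yIdeal K m k).comap (⋀[K]^k (Hankel.In m → K)).subtype := by
  rw [ker_wedge_eq_comap_Kr, Kr_w_ppSeq K m hm hk hkm ha hc]

end Summit.Ventures.HSemireg.Wedge.HankelPureKernel
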